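import Literature.Analysis.FunctionSpaces.PolchinskiExchangeSmoothedAux
import HarnessLib

/-!
# The tempered time-slope of the `e^{−V_t}`-weighted Fisher-information density
# (Bauerschmidt–Bodineau–Dagallier, proof of Theorem 3, smoothed class)

Topic `Literature/Analysis/FunctionSpaces`; "proof architecture" file behind the named fact
`Polchinski.BauerschmidtBodineau_multiscaleBakryEmery` ([BBD] Theorem 3, `MultiscaleBakryEmery.lean`),
companion of `PolchinskiExchangeSmoothedAux.lean` (the per-pair master bound
`sqrtEnergy_pair_bound`) and `PolchinskiExchangeSmoothed.lean` (the exchange inequality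
`k′ ≤ −2λ̇k` for the smoothed class).

Along the Polchinski flow started from `e^{−V₀} = Ψ` in the smoothed class, the weighted family
`K_s(y) = Z_s(y)·(∇√P_{0,s}F)²_{Ċ_s}(y) = ¼ Σ_{kl} Ċ_s^{kl} Z_s m_k m_l/u_s` is built from the atoms
`Z_s = E_{C_s}[Ψ(y+·)]`, `W_s = E_{C_s}[(ΨF)(y+·)]`, their first partials `Z_{s,k}`, `W_{s,k}`,
`u_s = W_s/Z_s`, `m_k = W_{s,k}/Z_s − u_s Z_{s,k}/Z_s`.  The tempered family rule
(`PolchinskiTemperedFamily.lean`) differentiates `s ↦ E_{C_∞−C_s}[K_s]` once the slope of `K_s` at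
`s = t` is controlled by `ε|s−t|e^{a‖y‖²}` for every `a > 0`, uniformly in `y`.  This file proves
that control (**`tempered_slope_sqrtEnergy`**) from purely scalar data: uniform slopes of the atoms
at `s = t` ([BBD] Prop 5), `P`-uniform jet bounds `|Z_{s,k}| ≤ c_δ Z_s^{1−δ}` (every `δ > 0`),
`aZ_s ≤ W_s ≤ bZ_s`, and a Gaussian lower bound `Z_s(y) ≥ m e^{−2c₂‖y‖²}` uniform in `s` near `t`.
The proof splits at a threshold `η`: where `Z_t(y) ≥ η` the second-order identity of
`sqrtEnergy_pair_bound` gives `O(ε₁|s−t| + |s−t|²)` with `η`-dependent constants; where `Z_t(y) < η`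
the point `y` is far out (`‖y‖² > R`), the tame bounds give `O(|s−t|)·C₂e^{2κ‖y‖²}` and the weight
`e^{a‖y‖²} = e^{8κ‖y‖²}` absorbs `C₂`.  Pure real analysis; no new definitions, no named facts.

Nothing here concerns Yang–Mills (no gauge instance of (e:assCt-mon) is in print; R4 =
`BalabanLadder.UV` only).

## References

* [BauerschmidtBodineauDagallier2023] R. Bauerschmidt, T. Bodineau, B. Dagallier, Probab. Surveys 21
  (2024) 200–290, arXiv:2307.07619 — Theorem 3 proof p0016 L47–153, Prop 5 p0014.
* [Rudin1976] W. Rudin, Principles of Mathematical Analysis — Thm 5.15 (Taylor).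
-/

noncomputable section

open Filter Topology

namespace Literature.Analysis.FunctionSpaces

namespace Polchinski

/-! ### Scalar helpers -/

section SlopeHelpers

/-- A fine slope `|X − Y − h d| ≤ e|h|` with `e ≤ 1`, `|d| ≤ K_D` gives the coarse increment bound
`|X − Y| ≤ (K_D + 1)|h|`. [folklore] -/
private theorem coarse_of_fine {X Y d h e KD : ℝ} (hf : |X - Y - h * d| ≤ e * |h|) (he : e ≤ 1)
    (hd : |d| ≤ KD) : |X - Y| ≤ (KD + 1) * |h| := by
  have h1 : X - Y = (X - Y - h * d) + h * d := by ring
  rw [h1]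
  calc |(X - Y - h * d) + h * d| ≤ |X - Y - h * d| + |h * d| := abs_add_le _ _
    _ ≤ e * |h| + |h| * KD := by
        rw [abs_mul]; exact add_le_add hf (mul_le_mul_of_nonneg_left hd (abs_nonneg _))
    _ ≤ |h| + |h| * KD := by
        have h2 := mul_le_of_le_one_left (abs_nonneg h) he
        linarith
    _ = (KD + 1) * |h| := by ring

/-- Normalised increment of a quotient: `((X_s − X_t) − (X_t/Z_t)(Z_s − Z_t))/Z_s = X_s/Z_s − X_t/Z_t`.
[folklore] -/
private theorem normIncr_u {Zs Zt Ws Wt : ℝ} (hZs : Zs ≠ 0) (hZt : Zt ≠ 0) :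
    ((Ws - Wt) - Wt * Zt⁻¹ * (Zs - Zt)) * Zs⁻¹ = Ws * Zs⁻¹ - Wt * Zt⁻¹ := by
  field_simp
  ring

/-- Normalised increment of `m = W₁/Z − (W/Z)(Z₁/Z)`: the second-order combination of increments,
divided by `Z_s`, is exactly `m_s − m_t`. [folklore] -/
private theorem normIncr_m {Zs Zt Ws Wt P1 P0 Q1 Q0 : ℝ} (hZs : Zs ≠ 0) (hZt : Zt ≠ 0) :
    (((Q1 - Q0) - Q0 * Zt⁻¹ * (Zs - Zt)) - Ws * Zs⁻¹ * ((P1 - P0) - P0 * Zt⁻¹ * (Zs - Zt)) -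
      P0 * Zt⁻¹ * ((Ws - Wt) - Wt * Zt⁻¹ * (Zs - Zt))) * Zs⁻¹ =
    (Q1 * Zs⁻¹ - Ws * Zs⁻¹ * (P1 * Zs⁻¹)) - (Q0 * Zt⁻¹ - Wt * Zt⁻¹ * (P0 * Zt⁻¹)) := by
  field_simp
  ring

/-- Tame bound from a `Z^{1−δ}` bound and a Gaussian lower bound: `|X| ≤ cZ^{1−δ}` and
`Z ≥ m e^{−u}` with `δu ≤ κ` give `|X| ≤ (c/m^δ)e^{κ}·Z`. [folklore] -/
private theorem tame_of_rpow {X Z c m u κ δ : ℝ} (hZ : 0 < Z) (hm : 0 < m)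
    (hlow : m * Real.exp (-u) ≤ Z) (hc : 0 ≤ c) (hδ : 0 < δ) (huκ : δ * u ≤ κ)
    (hX : |X| ≤ c * Z ^ (1 - δ)) : |X| ≤ c / m ^ δ * Real.exp κ * Z := by
  have hmδ : 0 < m ^ δ := Real.rpow_pos_of_pos hm δ
  have hℓ : m ^ δ * Real.exp (-u * δ) ≤ Z ^ δ := by
    have h1 := Real.rpow_le_rpow (by positivity) hlow hδ.le
    rwa [Real.mul_rpow hm.le (Real.exp_pos _).le, ← Real.exp_mul] at h1
  have hexp0 : 0 < Real.exp (-u * δ) := Real.exp_pos _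
  calc |X| ≤ c * Z ^ (1 - δ) := hX
    _ = c * Z / Z ^ δ := by rw [Real.rpow_sub hZ, Real.rpow_one]; ring
    _ ≤ c * Z / (m ^ δ * Real.exp (-u * δ)) :=
        div_le_div_of_nonneg_left (by positivity) (by positivity) hℓ
    _ = c / m ^ δ * Real.exp (δ * u) * Z := by
        have he : Real.exp (δ * u) = (Real.exp (-u * δ))⁻¹ := by
          rw [← Real.exp_neg]; ring_nf
        rw [he]
        field_simp
    _ ≤ c / m ^ δ * Real.exp κ * Z :=
        mul_le_mul_of_nonneg_right (mul_le_mul_of_nonneg_left (Real.exp_le_exp.2 huκ)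
          (div_nonneg hc hmδ.le)) hZ.le

/-- `|¼ Σ_k Σ_l f_{kl}| ≤ ¼ n² c` when `|f_{kl}| ≤ c`. [folklore] -/
private theorem abs_quarter_sum_le {ι : Type*} [Fintype ι] {f : ι → ι → ℝ} {c : ℝ}
    (h : ∀ k l, |f k l| ≤ c) :
    |(1 / 4 : ℝ) * ∑ k, ∑ l, f k l| ≤ (1 / 4) * ((Fintype.card ι : ℝ) ^ 2 * c) := by
  rw [abs_mul, abs_of_pos (by norm_num : (0 : ℝ) < 1 / 4)]
  refine mul_le_mul_of_nonneg_left ?_ (by norm_num)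
  calc |∑ k, ∑ l, f k l| ≤ ∑ k, |∑ l, f k l| := Finset.abs_sum_le_sum_abs _ _
    _ ≤ ∑ k, ∑ l, |f k l| := Finset.sum_le_sum fun k _ => Finset.abs_sum_le_sum_abs _ _
    _ ≤ ∑ _k : ι, ∑ _l : ι, c := Finset.sum_le_sum fun k _ => Finset.sum_le_sum fun l _ => h k l
    _ = (Fintype.card ι : ℝ) ^ 2 * c := by
        simp only [Finset.sum_const, Finset.card_univ]; ring

/-- The right-hand side of `sqrtEnergy_pair_bound` is linear in the normalized-increment bounds
`D_u, D_m`: with `D_u = D_u′|h|`, `D_m = D_m′|h|` it equals `|h|(eΦ₁ + |h|(Φ₂ + Φ₃′))`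
(near-region bookkeeping). [folklore] -/
private theorem rhs_case1_eq (h e zB wB L KD KC KCd KZ a b Du' Dm' : ℝ) :
    |h| * (e * (KZ * (wB + b * zB) ^ 2 / a + (KCd + KC) * ((wB + b * zB) ^ 2 / a +
      (2 * ((1 + wB) + b * (1 + zB) + zB * (1 + b)) * (wB + b * zB) / a +
      (wB + b * zB) ^ 2 * (1 + b) / a ^ 2))) +
      |h| * (KCd * (KD * (wB + b * zB) ^ 2 / a +
      (2 * (KD * (1 + wB + zB + b + 2 * b * zB)) * (wB + b * zB) / a +
      (wB + b * zB) ^ 2 * (KD * (1 + b)) / a ^ 2))) +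
      (KCd + KC) * ((((1 + wB) * L + b * ((1 + zB) * L) + zB * ((1 + b) * L)) +
      (wB + b * zB) * ((1 + b) * L) / a) * ((Dm' * |h|) + (wB + b * zB) * (Du' * |h|) / a) / a +
      2 * (wB + b * zB) * ((1 + zB) * L) * (Du' * |h|) / a)) =
    |h| * (e * (KZ * (wB + b * zB) ^ 2 / a + (KCd + KC) * ((wB + b * zB) ^ 2 / a +
      (2 * ((1 + wB) + b * (1 + zB) + zB * (1 + b)) * (wB + b * zB) / a +
      (wB + b * zB) ^ 2 * (1 + b) / a ^ 2))) +
      |h| * ((KCd * (KD * (wB + b * zB) ^ 2 / a +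
      (2 * (KD * (1 + wB + zB + b + 2 * b * zB)) * (wB + b * zB) / a +
      (wB + b * zB) ^ 2 * (KD * (1 + b)) / a ^ 2))) +
        ((KCd + KC) * ((((1 + wB) * L + b * ((1 + zB) * L) + zB * ((1 + b) * L)) +
      (wB + b * zB) * ((1 + b) * L) / a) * (Dm' + (wB + b * zB) * Du' / a) / a +
      2 * (wB + b * zB) * ((1 + zB) * L) * Du' / a)))) := by
  ring

/-- Far-region bookkeeping: with the tame atom bounds `z_B = z_Gγ`, `w_B = w_Gγ`, `D_m = 2m_Gγ`,
`D_u = b` (`γ ≥ 1`), every monomial of the right-hand side of `sqrtEnergy_pair_bound` has degree at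
most two in `γ`, whence `RHS ≤ |h|·C₂γ²` with `C₂` the bracket at `γ = 1`. [folklore] -/
private theorem rhs_case2_le {h e zG wG γ L KD KC KCd KZ a b : ℝ} (ha : 0 < a) (hb : 0 ≤ b)
    (hzG : 0 ≤ zG) (hwG : 0 ≤ wG) (hL : 0 ≤ L) (hKD : 0 ≤ KD) (hKC : 0 ≤ KC) (hKCd : 0 ≤ KCd)
    (hKZ : 0 ≤ KZ) (he1 : e ≤ 1) (hh : |h| ≤ 1) (hγ : 1 ≤ γ) :
    |h| * (e * (KZ * ((wG * γ) + b * (zG * γ)) ^ 2 / a + (KCd + KC) * (((wG * γ) + b * (zG * γ)) ^ 2 / a +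
      (2 * ((1 + (wG * γ)) + b * (1 + (zG * γ)) + (zG * γ) * (1 + b)) * ((wG * γ) + b * (zG * γ)) / a +
      ((wG * γ) + b * (zG * γ)) ^ 2 * (1 + b) / a ^ 2))) +
      |h| * (KCd * (KD * ((wG * γ) + b * (zG * γ)) ^ 2 / a +
      (2 * (KD * (1 + (wG * γ) + (zG * γ) + b + 2 * b * (zG * γ))) * ((wG * γ) + b * (zG * γ)) / a +
      ((wG * γ) + b * (zG * γ)) ^ 2 * (KD * (1 + b)) / a ^ 2))) +
      (KCd + KC) * ((((1 + (wG * γ)) * L + b * ((1 + (zG * γ)) * L) + (zG * γ) * ((1 + b) * L)) +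
      ((wG * γ) + b * (zG * γ)) * ((1 + b) * L) / a) * ((2 * (wG + b * zG) * γ) + ((wG * γ) + b * (zG * γ)) * b / a) / a +
      2 * ((wG * γ) + b * (zG * γ)) * ((1 + (zG * γ)) * L) * b / a)) ≤
    |h| * (((KZ * (wG + b * zG) ^ 2 / a + (KCd + KC) * ((wG + b * zG) ^ 2 / a +
      (2 * ((1 + wG) + b * (1 + zG) + zG * (1 + b)) * (wG + b * zG) / a +
      (wG + b * zG) ^ 2 * (1 + b) / a ^ 2))) +
      (KCd * (KD * (wG + b * zG) ^ 2 / a +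
      (2 * (KD * (1 + wG + zG + b + 2 * b * zG)) * (wG + b * zG) / a +
      (wG + b * zG) ^ 2 * (KD * (1 + b)) / a ^ 2))) +
      ((KCd + KC) * ((((1 + wG) * L + b * ((1 + zG) * L) + zG * ((1 + b) * L)) +
      (wG + b * zG) * ((1 + b) * L) / a) * ((2 * (wG + b * zG)) + (wG + b * zG) * b / a) / a +
      2 * (wG + b * zG) * ((1 + zG) * L) * b / a))) * γ ^ 2) := by
  have hγ0 : 0 ≤ γ := zero_le_one.trans hγ
  have hg : 0 ≤ γ - 1 := sub_nonneg.2 hγ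
  have hh0 : 0 ≤ |h| := abs_nonneg _
  have ha0 : 0 ≤ a := ha.le
  -- the three brackets at `γ`
  obtain ⟨A, hA⟩ : ∃ x : ℝ, x = (KZ * ((wG * γ) + b * (zG * γ)) ^ 2 / a + (KCd + KC) * (((wG * γ) + b * (zG * γ)) ^ 2 / a +
      (2 * ((1 + (wG * γ)) + b * (1 + (zG * γ)) + (zG * γ) * (1 + b)) * ((wG * γ) + b * (zG * γ)) / a +
      ((wG * γ) + b * (zG * γ)) ^ 2 * (1 + b) / a ^ 2))) := ⟨_, rfl⟩
  obtain ⟨Bq, hBq⟩ : ∃ x : ℝ, x = (KCd * (KD * ((wG * γ) + b * (zG * γ)) ^ 2 / a +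
      (2 * (KD * (1 + (wG * γ) + (zG * γ) + b + 2 * b * (zG * γ))) * ((wG * γ) + b * (zG * γ)) / a +
      ((wG * γ) + b * (zG * γ)) ^ 2 * (KD * (1 + b)) / a ^ 2))) := ⟨_, rfl⟩
  obtain ⟨Cq, hCq⟩ : ∃ x : ℝ, x = ((KCd + KC) * ((((1 + (wG * γ)) * L + b * ((1 + (zG * γ)) * L) + (zG * γ) * ((1 + b) * L)) +
      ((wG * γ) + b * (zG * γ)) * ((1 + b) * L) / a) * ((2 * (wG + b * zG) * γ) + ((wG * γ) + b * (zG * γ)) * b / a) / a +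
      2 * ((wG * γ) + b * (zG * γ)) * ((1 + (zG * γ)) * L) * b / a)) := ⟨_, rfl⟩
  -- and at `γ = 1`
  obtain ⟨A0, hA0⟩ : ∃ x : ℝ, x = (KZ * (wG + b * zG) ^ 2 / a + (KCd + KC) * ((wG + b * zG) ^ 2 / a +
      (2 * ((1 + wG) + b * (1 + zG) + zG * (1 + b)) * (wG + b * zG) / a +
      (wG + b * zG) ^ 2 * (1 + b) / a ^ 2))) := ⟨_, rfl⟩
  obtain ⟨B0, hB0⟩ : ∃ x : ℝ, x = (KCd * (KD * (wG + b * zG) ^ 2 / a +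
      (2 * (KD * (1 + wG + zG + b + 2 * b * zG)) * (wG + b * zG) / a +
      (wG + b * zG) ^ 2 * (KD * (1 + b)) / a ^ 2))) := ⟨_, rfl⟩
  obtain ⟨C0, hC0⟩ : ∃ x : ℝ, x = ((KCd + KC) * ((((1 + wG) * L + b * ((1 + zG) * L) + zG * ((1 + b) * L)) +
      (wG + b * zG) * ((1 + b) * L) / a) * ((2 * (wG + b * zG)) + (wG + b * zG) * b / a) / a +
      2 * (wG + b * zG) * ((1 + zG) * L) * b / a)) := ⟨_, rfl⟩
  rw [← hA, ← hBq, ← hCq, ← hA0, ← hB0, ← hC0]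
  have hApos : 0 ≤ A := by rw [hA]; positivity
  have hBpos : 0 ≤ Bq := by rw [hBq]; positivity
  have hCpos : 0 ≤ Cq := by rw [hCq]; positivity
  -- degree count, monomial by monomial (exact factorisations of the differences)
  have dA : A0 * γ ^ 2 - A = (KCd + KC) * (2 * ((1 + b) * (γ - 1)) * ((wG + b * zG) * γ) / a) := by
    rw [hA, hA0]; ring
  have dB : B0 * γ ^ 2 - Bq = KCd * (2 * (KD * ((1 + b) * (γ - 1))) * ((wG + b * zG) * γ) / a) := by
    rw [hBq, hB0]; ring
  have dC : C0 * γ ^ 2 - Cq = (KCd + KC) * (((1 + b) * L * (γ - 1)) * γ *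
      (2 * (wG + b * zG) + (wG + b * zG) * b / a) / a +
      2 * (wG + b * zG) * ((γ - 1) * γ * L) * b / a) := by
    rw [hCq, hC0]; ring
  have iA : A ≤ A0 * γ ^ 2 := by
    have : 0 ≤ (KCd + KC) * (2 * ((1 + b) * (γ - 1)) * ((wG + b * zG) * γ) / a) := by positivity
    linarith only [this, dA]
  have iB : Bq ≤ B0 * γ ^ 2 := by
    have : 0 ≤ KCd * (2 * (KD * ((1 + b) * (γ - 1))) * ((wG + b * zG) * γ) / a) := by positivity
    linarith only [this, dB]
  have iC : Cq ≤ C0 * γ ^ 2 := by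
    have : 0 ≤ (KCd + KC) * (((1 + b) * L * (γ - 1)) * γ *
        (2 * (wG + b * zG) + (wG + b * zG) * b / a) / a +
        2 * (wG + b * zG) * ((γ - 1) * γ * L) * b / a) := by positivity
    linarith only [this, dC]
  have i1 : e * A ≤ A := mul_le_of_le_one_left hApos he1
  have i2 : |h| * Bq ≤ Bq := mul_le_of_le_one_left hBpos hh
  calc |h| * (e * A + |h| * Bq + Cq) ≤ |h| * (A + Bq + Cq) :=
        mul_le_mul_of_nonneg_left (by linarith only [i1, i2]) hh0
    _ ≤ |h| * (A0 * γ ^ 2 + B0 * γ ^ 2 + C0 * γ ^ 2) :=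
        mul_le_mul_of_nonneg_left (add_le_add (add_le_add iA iB) iC) hh0
    _ = |h| * ((A0 + B0 + C0) * γ ^ 2) := by ring

end SlopeHelpers

/-! ### The tempered slope -/

section Slope

variable {E : Type*} [NormedAddCommGroup E] {ι : Type*} [Fintype ι]

set_option maxHeartbeats 4000000 in
/-- **Tempered time-slope of `K_s = Z_s(∇√P_{0,s}F)²_{Ċ_s}`** ([BBD] proof of Theorem 3, smoothed
class; the step that feeds the tempered family rule).  Scalar data: atoms `Z_s(y) > 0`, `Z_s ≤ B`,
`aZ_s ≤ W_s ≤ bZ_s` (`a > 0`); first partials `Z_{s,k}`, `W_{s,k}` with `P`-uniform tame bounds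
`|Z_{s,k}| ≤ c_δ Z_s^{1−δ}`, `|W_{s,k}| ≤ c_δ Z_s^{1−δ}` for every `δ > 0`; uniform slopes at `s = t` of
`Z, W, Z_{·,k}, W_{·,k}` ([BBD] Prop 5) and of the metric `Ċ`, with bounded slopes; a Gaussian lower
bound `Z_s(y) ≥ m e^{−2c₂‖y‖²}` for `s` near `t`.  If `K_s − K_t − (s−t)K̇` is the quarter-sum over
pairs of the quantity bounded in `sqrtEnergy_pair_bound`, then for every `a₀ > 0` and `ε > 0`,
eventually in `s` and uniformly in `y`, `|K_s(y) − K_t(y) − (s−t)K̇(y)| ≤ ε|s−t|e^{a₀‖y‖²}`.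
No claim about Yang–Mills is made. [cite: BauerschmidtBodineauDagallier2023, Theorem 3 (proof)] -/
theorem tempered_slope_sqrtEnergy
    {t : ℝ} {Z W : ℝ → E → ℝ} {Z1 W1 : ℝ → ι → E → ℝ} {Zd Wd : E → ℝ} {Z1d W1d : ι → E → ℝ}
    {Cf : ℝ → ι → ι → ℝ} {Cdd : ι → ι → ℝ} {K : ℝ → E → ℝ} {Kd : E → ℝ}
    {a b B KD KC m c₂ : ℝ}
    (hZpos : ∀ s y, 0 < Z s y) (hZle : ∀ s y, Z s y ≤ B) (ha : 0 < a)
    (hWa : ∀ s y, a * Z s y ≤ W s y) (hWb : ∀ s y, W s y ≤ b * Z s y)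
    (bZ1δ : ∀ δ : ℝ, 0 < δ → ∃ c : ℝ, 0 ≤ c ∧ ∀ s k y, |Z1 s k y| ≤ c * Z s y ^ (1 - δ))
    (bW1δ : ∀ δ : ℝ, 0 < δ → ∃ c : ℝ, 0 ≤ c ∧ ∀ s k y, |W1 s k y| ≤ c * Z s y ^ (1 - δ))
    (bC : ∀ s k l, |Cf s k l| ≤ KC)
    (bZd : ∀ y, |Zd y| ≤ KD) (bWd : ∀ y, |Wd y| ≤ KD) (bZ1d : ∀ k y, |Z1d k y| ≤ KD)
    (bW1d : ∀ k y, |W1d k y| ≤ KD)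
    (sZ : ∀ ε : ℝ, 0 < ε → ∀ᶠ s in 𝓝 t, ∀ y, |Z s y - Z t y - (s - t) * Zd y| ≤ ε * |s - t|)
    (sW : ∀ ε : ℝ, 0 < ε → ∀ᶠ s in 𝓝 t, ∀ y, |W s y - W t y - (s - t) * Wd y| ≤ ε * |s - t|)
    (sZ1 : ∀ ε : ℝ, 0 < ε → ∀ᶠ s in 𝓝 t, ∀ k y,
      |Z1 s k y - Z1 t k y - (s - t) * Z1d k y| ≤ ε * |s - t|)
    (sW1 : ∀ ε : ℝ, 0 < ε → ∀ᶠ s in 𝓝 t, ∀ k y,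
      |W1 s k y - W1 t k y - (s - t) * W1d k y| ≤ ε * |s - t|)
    (sCf : ∀ ε : ℝ, 0 < ε → ∀ᶠ s in 𝓝 t, ∀ k l,
      |Cf s k l - Cf t k l - (s - t) * Cdd k l| ≤ ε * |s - t|)
    (hm : 0 < m) (hc₂ : 0 ≤ c₂)
    (evG : ∀ᶠ s in 𝓝 t, ∀ y, m * Real.exp (-(2 * c₂ * ‖y‖ ^ 2)) ≤ Z s y)
    (hK : ∀ s y, K s y - K t y - (s - t) * Kd y = (1 / 4) * ∑ k, ∑ l,
      ((Cf s k l) * ((Z s y) * (((W1 s k y) * (Z s y)⁻¹ - (W s y) * (Z s y)⁻¹ * ((Z1 s k y) * (Z s y)⁻¹)) * ((W1 s l y) * (Z s y)⁻¹ - (W s y) * (Z s y)⁻¹ * ((Z1 s l y) * (Z s y)⁻¹)) *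
      ((W s y) * (Z s y)⁻¹)⁻¹)) -
      (Cf t k l) * ((Z t y) * (((W1 t k y) * (Z t y)⁻¹ - (W t y) * (Z t y)⁻¹ * ((Z1 t k y) * (Z t y)⁻¹)) * ((W1 t l y) * (Z t y)⁻¹ - (W t y) * (Z t y)⁻¹ * ((Z1 t l y) * (Z t y)⁻¹)) *
      ((W t y) * (Z t y)⁻¹)⁻¹)) -
      (s - t) * ((Cdd k l) * ((Z t y) * (((W1 t k y) * (Z t y)⁻¹ - (W t y) * (Z t y)⁻¹ * ((Z1 t k y) * (Z t y)⁻¹)) * ((W1 t l y) * (Z t y)⁻¹ - (W t y) * (Z t y)⁻¹ * ((Z1 t l y) * (Z t y)⁻¹)) *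
      ((W t y) * (Z t y)⁻¹)⁻¹)) +
      (Cf t k l) * ((Zd y) * (((W1 t k y) * (Z t y)⁻¹ - (W t y) * (Z t y)⁻¹ * ((Z1 t k y) * (Z t y)⁻¹)) * ((W1 t l y) * (Z t y)⁻¹ - (W t y) * (Z t y)⁻¹ * ((Z1 t l y) * (Z t y)⁻¹)) *
      ((W t y) * (Z t y)⁻¹)⁻¹) +
      (Z t y) * ((((W1d k y) * (Z t y)⁻¹ - (W1 t k y) * (Z t y)⁻¹ * ((Zd y) * (Z t y)⁻¹) - (Wd y) * (Z t y)⁻¹ * ((Z1 t k y) * (Z t y)⁻¹) - (W t y) * (Z t y)⁻¹ * ((Z1d k y) * (Z t y)⁻¹) +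
      2 * ((W t y) * (Z t y)⁻¹ * ((Z1 t k y) * (Z t y)⁻¹) * ((Zd y) * (Z t y)⁻¹))) * ((W1 t l y) * (Z t y)⁻¹ - (W t y) * (Z t y)⁻¹ * ((Z1 t l y) * (Z t y)⁻¹)) +
      ((W1 t k y) * (Z t y)⁻¹ - (W t y) * (Z t y)⁻¹ * ((Z1 t k y) * (Z t y)⁻¹)) *
      ((W1d l y) * (Z t y)⁻¹ - (W1 t l y) * (Z t y)⁻¹ * ((Zd y) * (Z t y)⁻¹) - (Wd y) * (Z t y)⁻¹ * ((Z1 t l y) * (Z t y)⁻¹) - (W t y) * (Z t y)⁻¹ * ((Z1d l y) * (Z t y)⁻¹) +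
      2 * ((W t y) * (Z t y)⁻¹ * ((Z1 t l y) * (Z t y)⁻¹) * ((Zd y) * (Z t y)⁻¹)))) * ((W t y) * (Z t y)⁻¹)⁻¹ -
      ((W1 t k y) * (Z t y)⁻¹ - (W t y) * (Z t y)⁻¹ * ((Z1 t k y) * (Z t y)⁻¹)) * ((W1 t l y) * (Z t y)⁻¹ - (W t y) * (Z t y)⁻¹ * ((Z1 t l y) * (Z t y)⁻¹)) *
      ((Wd y) * (Z t y)⁻¹ - (W t y) * (Z t y)⁻¹ * ((Zd y) * (Z t y)⁻¹)) * (((W t y) * (Z t y)⁻¹)⁻¹ * ((W t y) * (Z t y)⁻¹)⁻¹)))))) :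
    ∀ a₀ : ℝ, 0 < a₀ → ∀ ε : ℝ, 0 < ε → ∀ᶠ s in 𝓝 t, ∀ y,
      |K s y - K t y - (s - t) * Kd y| ≤ ε * |s - t| * Real.exp (a₀ * ‖y‖ ^ 2) := by
  classical
  intro a₀ ha₀ ε hε
  ---------------------------------------------------------------- basic constants
  obtain ⟨y0⟩ : Nonempty E := ⟨0⟩
  have hB : 0 < B := (hZpos t y0).trans_le (hZle t y0)
  have hab : a ≤ b := le_of_mul_le_mul_right ((hWa t y0).trans (hWb t y0)) (hZpos t y0)
  have hb0 : 0 ≤ b := ha.le.trans hab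
  have hKD0 : 0 ≤ KD := (abs_nonneg _).trans (bZd y0)
  obtain ⟨L, hL⟩ : ∃ x : ℝ, x = KD + 1 := ⟨_, rfl⟩
  have hL0 : 0 < L := by rw [hL]; positivity
  obtain ⟨KCd, hKCd⟩ : ∃ x : ℝ, x = ∑ k, ∑ l, |Cdd k l| := ⟨_, rfl⟩
  have hKCd0 : 0 ≤ KCd := by rw [hKCd]; positivity
  have bcd : ∀ k l, |Cdd k l| ≤ KCd := by
    intro k l
    rw [hKCd]
    exact (Finset.single_le_sum (f := fun l' => |Cdd k l'|) (fun _ _ => abs_nonneg _)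
      (Finset.mem_univ l)).trans (Finset.single_le_sum (f := fun k' => ∑ l', |Cdd k' l'|)
      (fun _ _ => Finset.sum_nonneg fun _ _ => abs_nonneg _) (Finset.mem_univ k))
  obtain ⟨KC', hKC'⟩ : ∃ x : ℝ, x = |KC| := ⟨_, rfl⟩
  have hKC'0 : 0 ≤ KC' := by rw [hKC']; exact abs_nonneg _
  have bC' : ∀ s k l, |Cf s k l| ≤ KC' := fun s k l => by
    rw [hKC']; exact (bC s k l).trans (le_abs_self _)
  ---------------------------------------------------------------- the exponents `κ = a₀/8`, `δ`
  obtain ⟨κ, hκ⟩ : ∃ x : ℝ, x = a₀ / 8 := ⟨_, rfl⟩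
  have hκ0 : 0 < κ := by rw [hκ]; positivity
  obtain ⟨δ, hδ⟩ : ∃ x : ℝ, x = a₀ / (8 * (2 * c₂ + 1)) := ⟨_, rfl⟩
  have hδ0 : 0 < δ := by rw [hδ]; positivity
  have hδκ : 2 * c₂ * δ ≤ κ := by
    have e1 : 2 * c₂ * δ = κ * (2 * c₂ / (2 * c₂ + 1)) := by rw [hδ, hκ]; field_simp
    have e2 : 2 * c₂ / (2 * c₂ + 1) ≤ 1 := (div_le_one (by positivity)).2 (by linarith)
    rw [e1]
    exact (mul_le_mul_of_nonneg_left e2 hκ0.le).trans_eq (mul_one κ)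
  -- tame constants for the far region
  obtain ⟨cZ, hcZ0, bZδ⟩ := bZ1δ δ hδ0
  obtain ⟨cW, hcW0, bWδ⟩ := bW1δ δ hδ0
  have hmδ : 0 < m ^ δ := Real.rpow_pos_of_pos hm δ
  obtain ⟨zG, hzG⟩ : ∃ x : ℝ, x = cZ / m ^ δ := ⟨_, rfl⟩
  obtain ⟨wG, hwG⟩ : ∃ x : ℝ, x = cW / m ^ δ := ⟨_, rfl⟩
  have hzG0 : 0 ≤ zG := by rw [hzG]; positivity
  have hwG0 : 0 ≤ wG := by rw [hwG]; positivity
  -- sup constants for the near region (`δ = 1/2`, `Z ≤ B`)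
  obtain ⟨cZh, hcZh0, bZh⟩ := bZ1δ (1 / 2) (by norm_num)
  obtain ⟨cWh, hcWh0, bWh⟩ := bW1δ (1 / 2) (by norm_num)
  obtain ⟨KZ1s, hKZ1s⟩ : ∃ x : ℝ, x = cZh * B ^ (1 - 1 / 2 : ℝ) := ⟨_, rfl⟩
  obtain ⟨KW1s, hKW1s⟩ : ∃ x : ℝ, x = cWh * B ^ (1 - 1 / 2 : ℝ) := ⟨_, rfl⟩
  have hKZ1s0 : 0 ≤ KZ1s := by rw [hKZ1s]; positivity
  have hKW1s0 : 0 ≤ KW1s := by rw [hKW1s]; positivity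
  have supZ1 : ∀ σ k y, |Z1 σ k y| ≤ KZ1s := fun σ k y => by
    rw [hKZ1s]
    exact (bZh σ k y).trans (mul_le_mul_of_nonneg_left
      (Real.rpow_le_rpow (hZpos σ y).le (hZle σ y) (by norm_num)) hcZh0)
  have supW1 : ∀ σ k y, |W1 σ k y| ≤ KW1s := fun σ k y => by
    rw [hKW1s]
    exact (bWh σ k y).trans (mul_le_mul_of_nonneg_left
      (Real.rpow_le_rpow (hZpos σ y).le (hZle σ y) (by norm_num)) hcWh0)
  ---------------------------------------------------------------- `C₂`, `εp`, `R`, `η`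
  obtain ⟨C₂, hC₂⟩ : ∃ x : ℝ, x =
      (B * (wG + b * zG) ^ 2 / a + (KCd + KC') * ((wG + b * zG) ^ 2 / a +
      (2 * ((1 + wG) + b * (1 + zG) + zG * (1 + b)) * (wG + b * zG) / a +
      (wG + b * zG) ^ 2 * (1 + b) / a ^ 2))) +
      (KCd * (KD * (wG + b * zG) ^ 2 / a +
      (2 * (KD * (1 + wG + zG + b + 2 * b * zG)) * (wG + b * zG) / a +
      (wG + b * zG) ^ 2 * (KD * (1 + b)) / a ^ 2))) +
      ((KCd + KC') * ((((1 + wG) * L + b * ((1 + zG) * L) + zG * ((1 + b) * L)) +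
      (wG + b * zG) * ((1 + b) * L) / a) * ((2 * (wG + b * zG)) + (wG + b * zG) * b / a) / a +
      2 * (wG + b * zG) * ((1 + zG) * L) * b / a)) := ⟨_, rfl⟩
  have hC₂0 : 0 ≤ C₂ := by rw [hC₂]; positivity
  obtain ⟨εp, hεp⟩ : ∃ x : ℝ, x = ε / ((Fintype.card ι : ℝ) ^ 2 + 1) := ⟨_, rfl⟩
  have hεp0 : 0 < εp := by rw [hεp]; positivity
  have hεpε : (1 / 4 : ℝ) * ((Fintype.card ι : ℝ) ^ 2 * εp) ≤ ε := by
    have hq : 0 ≤ (Fintype.card ι : ℝ) ^ 2 := by positivity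
    have key : (Fintype.card ι : ℝ) ^ 2 * εp ≤ ε := by
      rw [hεp, mul_div_assoc', div_le_iff₀ (by positivity)]
      linarith only [hε.le]
    linarith only [key, mul_nonneg hq hεp0.le]
  obtain ⟨R, hR⟩ : ∃ x : ℝ, x = Real.log (C₂ / εp + 1) / (6 * κ) := ⟨_, rfl⟩
  obtain ⟨η, hη⟩ : ∃ x : ℝ, x = m * Real.exp (-(2 * c₂ * R)) := ⟨_, rfl⟩
  have hη0 : 0 < η := by rw [hη]; positivity
  have hηne : η ≠ 0 := hη0.ne'
  ---------------------------------------------------------------- near-region constants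
  obtain ⟨zB₁, hzB₁⟩ : ∃ x : ℝ, x = 2 * KZ1s / η := ⟨_, rfl⟩
  obtain ⟨wB₁, hwB₁⟩ : ∃ x : ℝ, x = 2 * KW1s / η := ⟨_, rfl⟩
  have hzB₁0 : 0 ≤ zB₁ := by rw [hzB₁]; positivity
  have hwB₁0 : 0 ≤ wB₁ := by rw [hwB₁]; positivity
  obtain ⟨Du₁, hDu₁⟩ : ∃ x : ℝ, x = 2 * ((1 + b) * L) / η := ⟨_, rfl⟩
  obtain ⟨Dz₁, hDz₁⟩ : ∃ x : ℝ, x = 2 * ((1 + zB₁) * L) / η := ⟨_, rfl⟩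
  obtain ⟨Lm₁, hLm₁⟩ : ∃ x : ℝ, x = (1 + wB₁) * L + b * ((1 + zB₁) * L) + zB₁ * ((1 + b) * L) :=
    ⟨_, rfl⟩
  obtain ⟨Dm₁, hDm₁⟩ : ∃ x : ℝ, x = 2 * Lm₁ / η := ⟨_, rfl⟩
  have hDu₁0 : 0 ≤ Du₁ := by rw [hDu₁]; positivity
  have hLm₁0 : 0 ≤ Lm₁ := by rw [hLm₁]; positivity
  have hDm₁0 : 0 ≤ Dm₁ := by rw [hDm₁]; positivity
  obtain ⟨Φ₁, hΦ₁⟩ : ∃ x : ℝ, x =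
      (B * (wB₁ + b * zB₁) ^ 2 / a + (KCd + KC') * ((wB₁ + b * zB₁) ^ 2 / a +
      (2 * ((1 + wB₁) + b * (1 + zB₁) + zB₁ * (1 + b)) * (wB₁ + b * zB₁) / a +
      (wB₁ + b * zB₁) ^ 2 * (1 + b) / a ^ 2))) := ⟨_, rfl⟩
  obtain ⟨Φ₂₃, hΦ₂₃⟩ : ∃ x : ℝ, x =
      (KCd * (KD * (wB₁ + b * zB₁) ^ 2 / a +
      (2 * (KD * (1 + wB₁ + zB₁ + b + 2 * b * zB₁)) * (wB₁ + b * zB₁) / a +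
      (wB₁ + b * zB₁) ^ 2 * (KD * (1 + b)) / a ^ 2))) +
      ((KCd + KC') * ((((1 + wB₁) * L + b * ((1 + zB₁) * L) + zB₁ * ((1 + b) * L)) +
      (wB₁ + b * zB₁) * ((1 + b) * L) / a) * (Dm₁ + (wB₁ + b * zB₁) * Du₁ / a) / a +
      2 * (wB₁ + b * zB₁) * ((1 + zB₁) * L) * Du₁ / a)) := ⟨_, rfl⟩
  have hΦ₁0 : 0 ≤ Φ₁ := by rw [hΦ₁]; positivity
  have hΦ₂₃0 : 0 ≤ Φ₂₃ := by rw [hΦ₂₃]; positivity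
  obtain ⟨ε₁, hε₁⟩ : ∃ x : ℝ, x = min 1 (εp / (2 * (Φ₁ + 1))) := ⟨_, rfl⟩
  have hε₁0 : 0 < ε₁ := by rw [hε₁]; exact lt_min one_pos (by positivity)
  have hε₁1 : ε₁ ≤ 1 := by rw [hε₁]; exact min_le_left _ _
  have hε₁Φ : ε₁ * Φ₁ ≤ εp / 2 := by
    have h1 : ε₁ ≤ εp / (2 * (Φ₁ + 1)) := by rw [hε₁]; exact min_le_right _ _
    calc ε₁ * Φ₁ ≤ εp / (2 * (Φ₁ + 1)) * Φ₁ := mul_le_mul_of_nonneg_right h1 hΦ₁0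
      _ ≤ εp / (2 * (Φ₁ + 1)) * (Φ₁ + 1) :=
          mul_le_mul_of_nonneg_left (le_add_of_nonneg_right zero_le_one) (by positivity)
      _ = εp / 2 := by field_simp
  obtain ⟨ρ, hρ⟩ : ∃ x : ℝ, x = min 1 (min (η / (2 * L)) (εp / (2 * (Φ₂₃ + 1)))) := ⟨_, rfl⟩
  have hρ0 : 0 < ρ := by
    rw [hρ]; exact lt_min one_pos (lt_min (by positivity) (by positivity))
  have hρ1 : ρ ≤ 1 := by rw [hρ]; exact min_le_left _ _
  have hρη : ρ ≤ η / (2 * L) := by rw [hρ]; exact (min_le_right _ _).trans (min_le_left _ _)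
  have hρΦ : ρ ≤ εp / (2 * (Φ₂₃ + 1)) := by
    rw [hρ]; exact (min_le_right _ _).trans (min_le_right _ _)
  ---------------------------------------------------------------- the eventual set
  have evρ : ∀ᶠ s in 𝓝 t, |s - t| < ρ := by
    have h0 : Tendsto (fun s : ℝ => |s - t|) (𝓝 t) (𝓝 0) := by
      have h := (tendsto_id.sub_const t : Tendsto (fun s : ℝ => s - t) (𝓝 t) (𝓝 (t - t)))
      rw [sub_self] at h
      simpa using h.abs
    exact (tendsto_order.1 h0).2 _ hρ0
  have lowT : ∀ y, m * Real.exp (-(2 * c₂ * ‖y‖ ^ 2)) ≤ Z t y := evG.self_of_nhds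
  filter_upwards [sZ ε₁ hε₁0, sW ε₁ hε₁0, sZ1 ε₁ hε₁0, sW1 ε₁ hε₁0, sCf ε₁ hε₁0, evG, evρ]
    with s fZs fWs fZ1s fW1s fCs lowS hsρ y
  rw [hK s y]
  refine (abs_quarter_sum_le (c := εp * |s - t| * Real.exp (a₀ * ‖y‖ ^ 2))
    fun k l => ?_).trans ?_
  swap
  · have hE : 0 ≤ |s - t| * Real.exp (a₀ * ‖y‖ ^ 2) := by positivity
    have e1 : (1 / 4 : ℝ) * ((Fintype.card ι : ℝ) ^ 2 * (εp * |s - t| * Real.exp (a₀ * ‖y‖ ^ 2))) =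
        ((1 / 4) * ((Fintype.card ι : ℝ) ^ 2 * εp)) * (|s - t| * Real.exp (a₀ * ‖y‖ ^ 2)) := by
      ring
    rw [e1, mul_assoc ε]
    exact mul_le_mul_of_nonneg_right hεpε hE
  ---------------------------------------------------------------- the pair `(k, l)`: common data
  obtain ⟨h, hh⟩ : ∃ x : ℝ, x = s - t := ⟨_, rfl⟩
  rw [← hh]
  have hh1 : |h| ≤ 1 := by rw [hh]; exact hsρ.le.trans hρ1
  have hhρ : |h| ≤ ρ := by rw [hh]; exact hsρ.le
  have hh0 : 0 ≤ |h| := abs_nonneg _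
  have hZs : 0 < Z s y := hZpos s y
  have hZt : 0 < Z t y := hZpos t y
  have hZsne : Z s y ≠ 0 := hZs.ne'
  have hZtne : Z t y ≠ 0 := hZt.ne'
  have hWs : a * Z s y ≤ W s y := hWa s y
  have hWs' : W s y ≤ b * Z s y := hWb s y
  have hWt : a * Z t y ≤ W t y := hWa t y
  have hWt' : W t y ≤ b * Z t y := hWb t y
  have hKZ : Z s y ≤ B := hZle s y
  -- fine slopes at precision `ε₁`
  have fZ : |Z s y - Z t y - h * Zd y| ≤ ε₁ * |h| := by rw [hh]; exact fZs y
  have fW : |W s y - W t y - h * Wd y| ≤ ε₁ * |h| := by rw [hh]; exact fWs y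
  have fP : |Z1 s k y - Z1 t k y - h * Z1d k y| ≤ ε₁ * |h| := by rw [hh]; exact fZ1s k y
  have fQ : |W1 s k y - W1 t k y - h * W1d k y| ≤ ε₁ * |h| := by rw [hh]; exact fW1s k y
  have fR : |Z1 s l y - Z1 t l y - h * Z1d l y| ≤ ε₁ * |h| := by rw [hh]; exact fZ1s l y
  have fS : |W1 s l y - W1 t l y - h * W1d l y| ≤ ε₁ * |h| := by rw [hh]; exact fW1s l y
  have fC : |Cf s k l - Cf t k l - h * Cdd k l| ≤ ε₁ * |h| := by rw [hh]; exact fCs k l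
  -- coarse increments
  have cZ : |Z s y - Z t y| ≤ L * |h| := by rw [hL]; exact coarse_of_fine fZ hε₁1 (bZd y)
  have cW : |W s y - W t y| ≤ L * |h| := by rw [hL]; exact coarse_of_fine fW hε₁1 (bWd y)
  have cP : |Z1 s k y - Z1 t k y| ≤ L * |h| := by rw [hL]; exact coarse_of_fine fP hε₁1 (bZ1d k y)
  have cQ : |W1 s k y - W1 t k y| ≤ L * |h| := by rw [hL]; exact coarse_of_fine fQ hε₁1 (bW1d k y)
  have cR : |Z1 s l y - Z1 t l y| ≤ L * |h| := by rw [hL]; exact coarse_of_fine fR hε₁1 (bZ1d l y)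
  have cS : |W1 s l y - W1 t l y| ≤ L * |h| := by rw [hL]; exact coarse_of_fine fS hε₁1 (bW1d l y)
  -- the quotients `u_s`, `u_t`
  have hus : a ≤ W s y * (Z s y)⁻¹ ∧ W s y * (Z s y)⁻¹ ≤ b := by
    rw [← div_eq_mul_inv, le_div_iff₀ hZs, div_le_iff₀ hZs]; exact ⟨hWs, hWs'⟩
  have hut : a ≤ W t y * (Z t y)⁻¹ ∧ W t y * (Z t y)⁻¹ ≤ b := by
    rw [← div_eq_mul_inv, le_div_iff₀ hZt, div_le_iff₀ hZt]; exact ⟨hWt, hWt'⟩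
  have husabs : |W s y * (Z s y)⁻¹| ≤ b := by
    rw [abs_of_pos (ha.trans_le hus.1)]; exact hus.2
  have hutabs : |W t y * (Z t y)⁻¹| ≤ b := by
    rw [abs_of_pos (ha.trans_le hut.1)]; exact hut.2
  have hexp1 : 1 ≤ Real.exp (a₀ * ‖y‖ ^ 2) := Real.one_le_exp (by positivity)
  -- normalized atom bound
  have nb : ∀ {X Zσ c : ℝ}, 0 < Zσ → |X| ≤ c * Zσ → |X * Zσ⁻¹| ≤ c := fun hZσ hX => by
    rw [abs_mul, abs_inv, abs_of_pos hZσ, ← div_eq_mul_inv, div_le_iff₀ hZσ]; exact hX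
  -- the `u`-part of the second-order increments
  have bDu : |(W s y - W t y) - W t y * (Z t y)⁻¹ * (Z s y - Z t y)| ≤ (1 + b) * L * |h| := by
    calc _ ≤ |W s y - W t y| + |W t y * (Z t y)⁻¹ * (Z s y - Z t y)| := abs_sub _ _
      _ ≤ L * |h| + b * (L * |h|) := by
          rw [abs_mul (W t y * (Z t y)⁻¹)]
          exact add_le_add cW (mul_le_mul hutabs cZ (abs_nonneg _) hb0)
      _ = (1 + b) * L * |h| := by ring
  have bDz : ∀ {P1' P0' zX : ℝ}, |P1' - P0'| ≤ L * |h| → |P0'| ≤ zX * Z t y → 0 ≤ zX →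
      |(P1' - P0') - P0' * (Z t y)⁻¹ * (Z s y - Z t y)| ≤ (1 + zX) * L * |h| := by
    intro P1' P0' zX cP' hP0' hzX
    calc _ ≤ |P1' - P0'| + |P0' * (Z t y)⁻¹ * (Z s y - Z t y)| := abs_sub _ _
      _ ≤ L * |h| + zX * (L * |h|) := by
          rw [abs_mul (P0' * (Z t y)⁻¹)]
          exact add_le_add cP' (mul_le_mul (nb hZt hP0') cZ (abs_nonneg _) hzX)
      _ = (1 + zX) * L * |h| := by ring
  have bDm : ∀ {Q1' Q0' P1' P0' zX wX : ℝ}, |Q1' - Q0'| ≤ L * |h| → |Q0'| ≤ wX * Z t y →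
      |P1' - P0'| ≤ L * |h| → |P0'| ≤ zX * Z t y → 0 ≤ zX → 0 ≤ wX →
      |((Q1' - Q0') - Q0' * (Z t y)⁻¹ * (Z s y - Z t y)) -
          W s y * (Z s y)⁻¹ * ((P1' - P0') - P0' * (Z t y)⁻¹ * (Z s y - Z t y)) -
          P0' * (Z t y)⁻¹ * ((W s y - W t y) - W t y * (Z t y)⁻¹ * (Z s y - Z t y))| ≤
        ((1 + wX) * L + b * ((1 + zX) * L) + zX * ((1 + b) * L)) * |h| := by
    intro Q1' Q0' P1' P0' zX wX cQ' hQ0' cP' hP0' hzX hwX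
    calc _ ≤ |(Q1' - Q0') - Q0' * (Z t y)⁻¹ * (Z s y - Z t y)| +
          |W s y * (Z s y)⁻¹ * ((P1' - P0') - P0' * (Z t y)⁻¹ * (Z s y - Z t y))| +
          |P0' * (Z t y)⁻¹ * ((W s y - W t y) - W t y * (Z t y)⁻¹ * (Z s y - Z t y))| :=
          (abs_sub _ _).trans (add_le_add (abs_sub _ _) le_rfl)
      _ ≤ (1 + wX) * L * |h| + b * ((1 + zX) * L * |h|) + zX * ((1 + b) * L * |h|) := by
          rw [abs_mul (W s y * (Z s y)⁻¹), abs_mul (P0' * (Z t y)⁻¹)]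
          exact add_le_add (add_le_add (bDz cQ' hQ0' hwX)
            (mul_le_mul husabs (bDz cP' hP0' hzX) (abs_nonneg _) hb0))
            (mul_le_mul (nb hZt hP0') bDu (abs_nonneg _) hzX)
      _ = ((1 + wX) * L + b * ((1 + zX) * L) + zX * ((1 + b) * L)) * |h| := by ring
  by_cases hcase : η ≤ Z t y
  · ---------------------------------------------------------------- Case 1: `Z_t(y) ≥ η`
    have hZs_low : η / 2 ≤ Z s y := by
      have h2 : L * |h| ≤ η / 2 := by
        calc L * |h| ≤ L * (η / (2 * L)) := mul_le_mul_of_nonneg_left (hhρ.trans hρη) hL0.le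
          _ = η / 2 := by field_simp
      have h3 := (abs_le.1 cZ).1
      linarith only [h2, h3, hcase]
    have hiZs : (Z s y)⁻¹ ≤ 2 / η := by
      rw [inv_le_comm₀ hZs (by positivity), inv_div]; exact hZs_low
    -- atom bounds `|P| ≤ z_B Z`
    have nbt : ∀ {X KX : ℝ}, |X| ≤ KX → 0 ≤ KX → |X| ≤ 2 * KX / η * Z t y := by
      intro X KX hX hKX
      have e1 : 2 * KX / η * (η / 2) = KX := by field_simp
      calc |X| ≤ KX := hX
        _ = 2 * KX / η * (η / 2) := e1.symm
        _ ≤ 2 * KX / η * Z t y :=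
            mul_le_mul_of_nonneg_left (by linarith only [hcase, hη0]) (by positivity)
    have nbs : ∀ {X KX : ℝ}, |X| ≤ KX → 0 ≤ KX → |X| ≤ 2 * KX / η * Z s y := by
      intro X KX hX hKX
      have e1 : 2 * KX / η * (η / 2) = KX := by field_simp
      calc |X| ≤ KX := hX
        _ = 2 * KX / η * (η / 2) := e1.symm
        _ ≤ 2 * KX / η * Z s y := mul_le_mul_of_nonneg_left hZs_low (by positivity)
    have hP0 : |Z1 t k y| ≤ zB₁ * Z t y := by rw [hzB₁]; exact nbt (supZ1 t k y) hKZ1s0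
    have hP1 : |Z1 s k y| ≤ zB₁ * Z s y := by rw [hzB₁]; exact nbs (supZ1 s k y) hKZ1s0
    have hQ0 : |W1 t k y| ≤ wB₁ * Z t y := by rw [hwB₁]; exact nbt (supW1 t k y) hKW1s0
    have hQ1 : |W1 s k y| ≤ wB₁ * Z s y := by rw [hwB₁]; exact nbs (supW1 s k y) hKW1s0
    have hR0 : |Z1 t l y| ≤ zB₁ * Z t y := by rw [hzB₁]; exact nbt (supZ1 t l y) hKZ1s0
    have hR1 : |Z1 s l y| ≤ zB₁ * Z s y := by rw [hzB₁]; exact nbs (supZ1 s l y) hKZ1s0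
    have hS0 : |W1 t l y| ≤ wB₁ * Z t y := by rw [hwB₁]; exact nbt (supW1 t l y) hKW1s0
    have hS1 : |W1 s l y| ≤ wB₁ * Z s y := by rw [hwB₁]; exact nbs (supW1 s l y) hKW1s0
    -- normalized increments are `O(|h|/η)`
    have nrm : ∀ {X c : ℝ}, |X| ≤ c * |h| → 0 ≤ c → |X * (Z s y)⁻¹| ≤ 2 * c / η * |h| := by
      intro X c hX hc
      rw [abs_mul, abs_inv, abs_of_pos hZs]
      calc |X| * (Z s y)⁻¹ ≤ c * |h| * (2 / η) :=
            mul_le_mul hX hiZs (inv_nonneg.2 hZs.le) (by positivity)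
        _ = 2 * c / η * |h| := by ring
    have dU : |((W s y - W t y) - W t y * (Z t y)⁻¹ * (Z s y - Z t y)) * (Z s y)⁻¹| ≤
        Du₁ * |h| := by
      rw [hDu₁]; exact nrm bDu (by positivity)
    have dZk : |((Z1 s k y - Z1 t k y) - Z1 t k y * (Z t y)⁻¹ * (Z s y - Z t y)) * (Z s y)⁻¹| ≤
        Dz₁ * |h| := by
      rw [hDz₁]; exact nrm (bDz cP hP0 hzB₁0) (by positivity)
    have dZl : |((Z1 s l y - Z1 t l y) - Z1 t l y * (Z t y)⁻¹ * (Z s y - Z t y)) * (Z s y)⁻¹| ≤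
        Dz₁ * |h| := by
      rw [hDz₁]; exact nrm (bDz cR hR0 hzB₁0) (by positivity)
    have dMk : |(((W1 s k y - W1 t k y) - W1 t k y * (Z t y)⁻¹ * (Z s y - Z t y)) -
        W s y * (Z s y)⁻¹ * ((Z1 s k y - Z1 t k y) - Z1 t k y * (Z t y)⁻¹ * (Z s y - Z t y)) -
        Z1 t k y * (Z t y)⁻¹ * ((W s y - W t y) - W t y * (Z t y)⁻¹ * (Z s y - Z t y))) *
          (Z s y)⁻¹| ≤ Dm₁ * |h| := by
      rw [hDm₁]; exact nrm (by rw [hLm₁]; exact bDm cQ hQ0 cP hP0 hzB₁0 hwB₁0) hLm₁0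
    have dMl : |(((W1 s l y - W1 t l y) - W1 t l y * (Z t y)⁻¹ * (Z s y - Z t y)) -
        W s y * (Z s y)⁻¹ * ((Z1 s l y - Z1 t l y) - Z1 t l y * (Z t y)⁻¹ * (Z s y - Z t y)) -
        Z1 t l y * (Z t y)⁻¹ * ((W s y - W t y) - W t y * (Z t y)⁻¹ * (Z s y - Z t y))) *
          (Z s y)⁻¹| ≤ Dm₁ * |h| := by
      rw [hDm₁]; exact nrm (by rw [hLm₁]; exact bDm cS hS0 cR hR0 hzB₁0 hwB₁0) hLm₁0
    -- the master bound, near-region constants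
    have hT := sqrtEnergy_pair_bound (e := ε₁) (zB := zB₁) (wB := wB₁) (L := L) (KD := KD)
      (KC := KC') (KCd := KCd) (KZ := B) (Du := Du₁ * |h|) (Dz := Dz₁ * |h|) (Dm := Dm₁ * |h|)
      hZs hZt ha hWs hWs' hWt hWt' hKZ hzB₁0 hwB₁0 hL0.le hKD0 hKC'0 hKCd0 (by positivity)
      (by positivity) hε₁0.le hh1 hP0 hP1 hQ0 hQ1 hR0 hR1 hS0 hS1 cZ cW cP cQ cR cS
      fZ fW fP fQ fR fS fC (bZd y) (bWd y) (bZ1d k y) (bW1d k y) (bZ1d l y) (bW1d l y)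
      (bC' t k l) (bcd k l) dU dZk dZl dMk dMl
    have hT' := hT.trans_eq (rhs_case1_eq h ε₁ zB₁ wB₁ L KD KC' KCd B a b Du₁ Dm₁)
    rw [← hΦ₁, ← hΦ₂₃] at hT'
    refine hT'.trans ?_
    have h2 : |h| * Φ₂₃ ≤ εp / 2 := by
      calc |h| * Φ₂₃ ≤ εp / (2 * (Φ₂₃ + 1)) * Φ₂₃ :=
            mul_le_mul_of_nonneg_right (hhρ.trans hρΦ) hΦ₂₃0
        _ ≤ εp / (2 * (Φ₂₃ + 1)) * (Φ₂₃ + 1) :=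
            mul_le_mul_of_nonneg_left (le_add_of_nonneg_right zero_le_one) (by positivity)
        _ = εp / 2 := by field_simp
    calc |h| * (ε₁ * Φ₁ + |h| * Φ₂₃) ≤ |h| * (εp / 2 + εp / 2) :=
          mul_le_mul_of_nonneg_left (add_le_add hε₁Φ h2) hh0
      _ = εp * |h| * 1 := by ring
      _ ≤ εp * |h| * Real.exp (a₀ * ‖y‖ ^ 2) := mul_le_mul_of_nonneg_left hexp1 (by positivity)
  · ---------------------------------------------------------------- Case 2: `Z_t(y) < η`, `y` far out
    push Not at hcase
    obtain ⟨γ, hγ⟩ : ∃ x : ℝ, x = Real.exp (κ * ‖y‖ ^ 2) := ⟨_, rfl⟩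
    have hγ1 : 1 ≤ γ := by rw [hγ]; exact Real.one_le_exp (by positivity)
    have hγ0 : 0 < γ := by rw [hγ]; exact Real.exp_pos _
    have hδy : δ * (2 * c₂ * ‖y‖ ^ 2) ≤ κ * ‖y‖ ^ 2 := by
      have h1 := mul_le_mul_of_nonneg_right hδκ (sq_nonneg ‖y‖)
      linarith only [h1]
    -- tame atom bounds `|P| ≤ (z_G γ) Z`
    have tm : ∀ {σ X c : ℝ}, m * Real.exp (-(2 * c₂ * ‖y‖ ^ 2)) ≤ Z σ y → 0 ≤ c →
        |X| ≤ c * Z σ y ^ (1 - δ) → |X| ≤ c / m ^ δ * γ * Z σ y := by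
      intro σ X c hlow hc hX
      rw [hγ]
      exact tame_of_rpow (hZpos σ y) hm hlow hc hδ0 hδy hX
    have hP0 : |Z1 t k y| ≤ zG * γ * Z t y := by rw [hzG]; exact tm (lowT y) hcZ0 (bZδ t k y)
    have hP1 : |Z1 s k y| ≤ zG * γ * Z s y := by rw [hzG]; exact tm (lowS y) hcZ0 (bZδ s k y)
    have hQ0 : |W1 t k y| ≤ wG * γ * Z t y := by rw [hwG]; exact tm (lowT y) hcW0 (bWδ t k y)
    have hQ1 : |W1 s k y| ≤ wG * γ * Z s y := by rw [hwG]; exact tm (lowS y) hcW0 (bWδ s k y)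
    have hR0 : |Z1 t l y| ≤ zG * γ * Z t y := by rw [hzG]; exact tm (lowT y) hcZ0 (bZδ t l y)
    have hR1 : |Z1 s l y| ≤ zG * γ * Z s y := by rw [hzG]; exact tm (lowS y) hcZ0 (bZδ s l y)
    have hS0 : |W1 t l y| ≤ wG * γ * Z t y := by rw [hwG]; exact tm (lowT y) hcW0 (bWδ t l y)
    have hS1 : |W1 s l y| ≤ wG * γ * Z s y := by rw [hwG]; exact tm (lowS y) hcW0 (bWδ s l y)
    have hzγ : 0 ≤ zG * γ := by positivity
    have hwγ : 0 ≤ wG * γ := by positivity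
    -- normalized increments are `O(γ)` (exact identities)
    have dU : |((W s y - W t y) - W t y * (Z t y)⁻¹ * (Z s y - Z t y)) * (Z s y)⁻¹| ≤ b := by
      rw [normIncr_u hZsne hZtne]
      exact abs_sub_le_iff.2 ⟨by linarith only [hus.2, hut.1, ha], by linarith only [hut.2, hus.1, ha]⟩
    have dZ : ∀ {P1' P0' : ℝ}, |P0'| ≤ zG * γ * Z t y → |P1'| ≤ zG * γ * Z s y →
        |((P1' - P0') - P0' * (Z t y)⁻¹ * (Z s y - Z t y)) * (Z s y)⁻¹| ≤ 2 * zG * γ := by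
      intro P1' P0' h0 h1
      rw [normIncr_u hZsne hZtne]
      calc |P1' * (Z s y)⁻¹ - P0' * (Z t y)⁻¹| ≤ |P1' * (Z s y)⁻¹| + |P0' * (Z t y)⁻¹| :=
            abs_sub _ _
        _ ≤ zG * γ + zG * γ := add_le_add (nb hZs h1) (nb hZt h0)
        _ = 2 * zG * γ := by ring
    have dM : ∀ {Q1' Q0' P1' P0' : ℝ}, |Q0'| ≤ wG * γ * Z t y → |Q1'| ≤ wG * γ * Z s y →
        |P0'| ≤ zG * γ * Z t y → |P1'| ≤ zG * γ * Z s y →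
        |(((Q1' - Q0') - Q0' * (Z t y)⁻¹ * (Z s y - Z t y)) -
          W s y * (Z s y)⁻¹ * ((P1' - P0') - P0' * (Z t y)⁻¹ * (Z s y - Z t y)) -
          P0' * (Z t y)⁻¹ * ((W s y - W t y) - W t y * (Z t y)⁻¹ * (Z s y - Z t y))) *
            (Z s y)⁻¹| ≤ 2 * (wG + b * zG) * γ := by
      intro Q1' Q0' P1' P0' hQ0' hQ1' hP0' hP1'
      rw [normIncr_m hZsne hZtne]
      have m1 : |Q1' * (Z s y)⁻¹ - W s y * (Z s y)⁻¹ * (P1' * (Z s y)⁻¹)| ≤ wG * γ + b * (zG * γ) := by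
        calc _ ≤ |Q1' * (Z s y)⁻¹| + |W s y * (Z s y)⁻¹ * (P1' * (Z s y)⁻¹)| := abs_sub _ _
          _ ≤ wG * γ + b * (zG * γ) := by
              rw [abs_mul (W s y * (Z s y)⁻¹)]
              exact add_le_add (nb hZs hQ1') (mul_le_mul husabs (nb hZs hP1') (abs_nonneg _) hb0)
      have m0 : |Q0' * (Z t y)⁻¹ - W t y * (Z t y)⁻¹ * (P0' * (Z t y)⁻¹)| ≤ wG * γ + b * (zG * γ) := by
        calc _ ≤ |Q0' * (Z t y)⁻¹| + |W t y * (Z t y)⁻¹ * (P0' * (Z t y)⁻¹)| := abs_sub _ _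
          _ ≤ wG * γ + b * (zG * γ) := by
              rw [abs_mul (W t y * (Z t y)⁻¹)]
              exact add_le_add (nb hZt hQ0') (mul_le_mul hutabs (nb hZt hP0') (abs_nonneg _) hb0)
      calc _ ≤ |Q1' * (Z s y)⁻¹ - W s y * (Z s y)⁻¹ * (P1' * (Z s y)⁻¹)| +
            |Q0' * (Z t y)⁻¹ - W t y * (Z t y)⁻¹ * (P0' * (Z t y)⁻¹)| := abs_sub _ _
        _ ≤ (wG * γ + b * (zG * γ)) + (wG * γ + b * (zG * γ)) := add_le_add m1 m0
        _ = 2 * (wG + b * zG) * γ := by ring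
    -- the master bound, far-region constants
    have hT := sqrtEnergy_pair_bound (e := ε₁) (zB := zG * γ) (wB := wG * γ) (L := L) (KD := KD)
      (KC := KC') (KCd := KCd) (KZ := B) (Du := b) (Dz := 2 * zG * γ)
      (Dm := 2 * (wG + b * zG) * γ)
      hZs hZt ha hWs hWs' hWt hWt' hKZ hzγ hwγ hL0.le hKD0 hKC'0 hKCd0 hb0
      (by positivity) hε₁0.le hh1 hP0 hP1 hQ0 hQ1 hR0 hR1 hS0 hS1 cZ cW cP cQ cR cS
      fZ fW fP fQ fR fS fC (bZd y) (bWd y) (bZ1d k y) (bW1d k y) (bZ1d l y) (bW1d l y)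
      (bC' t k l) (bcd k l) dU (dZ hP0 hP1) (dZ hR0 hR1) (dM hQ0 hQ1 hP0 hP1)
      (dM hS0 hS1 hR0 hR1)
    have hT2 := hT.trans (rhs_case2_le ha hb0 hzG0 hwG0 hL0.le hKD0 hKC'0 hKCd0 hB.le
      hε₁1 hh1 hγ1)
    rw [← hC₂] at hT2
    -- far out: `C₂ γ² ≤ εp γ⁸ = εp e^{a₀‖y‖²}`
    have hfar : C₂ * γ ^ 2 ≤ εp * Real.exp (a₀ * ‖y‖ ^ 2) := by
      have h1 : m * Real.exp (-(2 * c₂ * ‖y‖ ^ 2)) < m * Real.exp (-(2 * c₂ * R)) := by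
        rw [← hη]; exact (lowT y).trans_lt hcase
      have h2 : Real.exp (-(2 * c₂ * ‖y‖ ^ 2)) < Real.exp (-(2 * c₂ * R)) :=
        lt_of_mul_lt_mul_left h1 hm.le
      rw [Real.exp_lt_exp] at h2
      have h3 : R < ‖y‖ ^ 2 := by
        by_contra hcon
        push Not at hcon
        have h3' := mul_le_mul_of_nonneg_left hcon (by positivity : (0 : ℝ) ≤ 2 * c₂)
        linarith only [h3', h2]
      have h4 : Real.log (C₂ / εp + 1) < 6 * (κ * ‖y‖ ^ 2) := by
        have e6 : Real.log (C₂ / εp + 1) = 6 * κ * R := by rw [hR]; field_simp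
        rw [e6]
        have h4' := mul_lt_mul_of_pos_left h3 hκ0
        linarith only [h4']
      have h5 : C₂ / εp + 1 < γ ^ 6 := by
        calc C₂ / εp + 1 = Real.exp (Real.log (C₂ / εp + 1)) := (Real.exp_log (by positivity)).symm
          _ < Real.exp (6 * (κ * ‖y‖ ^ 2)) := Real.exp_lt_exp.2 h4
          _ = γ ^ 6 := by rw [hγ, ← Real.exp_nat_mul]; norm_num
      have h6 : C₂ ≤ εp * γ ^ 6 := by
        have h7 : C₂ / εp ≤ γ ^ 6 := by linarith only [h5]
        rw [div_le_iff₀ hεp0] at h7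
        exact h7.trans_eq (mul_comm _ _)
      have h8 : γ ^ 8 = Real.exp (a₀ * ‖y‖ ^ 2) := by
        rw [hγ, ← Real.exp_nat_mul, hκ]
        congr 1
        push_cast
        ring
      calc C₂ * γ ^ 2 ≤ εp * γ ^ 6 * γ ^ 2 := mul_le_mul_of_nonneg_right h6 (by positivity)
        _ = εp * γ ^ 8 := by ring
        _ = εp * Real.exp (a₀ * ‖y‖ ^ 2) := by rw [h8]
    refine hT2.trans ?_
    calc |h| * (C₂ * γ ^ 2) ≤ |h| * (εp * Real.exp (a₀ * ‖y‖ ^ 2)) :=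
          mul_le_mul_of_nonneg_left hfar hh0
      _ = εp * |h| * Real.exp (a₀ * ‖y‖ ^ 2) := by ring

end Slope

end Polchinski

end Literature.Analysis.FunctionSpaces

end
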